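import Summits.BirchSwinnertonDyer.Rank1Residual.X11b.KolyvaginShaAtPrimeDischarged
import Literature.NumberTheory.EllipticCurves.GrossLMS1991.HeegnerEulerSystemCongruence
import HarnessLib

/-!
# `Ш(E/K)[p^∞]` at ONE odd surjective prime `p` on the Kodaira–Néron sub-class (KN_p)
# modulo ONE NAMED published fact — Gross 1991 Prop. 3.7 (2) BY NAME
# (the generic-prime X11b Kolyvagin ENDs with the last inline cite-only binder `hγ` RE-POINTED)

Cell `b2b-bsdres`, team x11b3 (N8/O2); seat x11b3-p2 GEN 53 (unit claimed D-0075 → BSD:K2/P4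
«Kolyvagin-in-kernel»).  Summit-side THEOREM-ONLY file (no definition, no named fact, no `sorry`);
`K : Type`; ONE generic odd prime `p` with `ρ̄_{E,p}` onto.

HONEST FRAMING (cell `b2b-bsdres`, run/shared/lean/b2b/bsd-rank1-residual/, verbatim in every
file): the goal of the cell is to DELETE the COMBINATION-SHAPED residual classes of the
Birch–Swinnerton-Dyer formula for ALL analytic-rank `≤ 1` elliptic curves over `ℚ` — "full BSD
formula for every rank `≤ 1` curve in class `C`" assembled STRICTLY from published theorems — so
that the rank-`≤ 1` remainder becomes exactly the CONSTRUCTION-SHAPED classes, which are TYPED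
(missing-input `Prop`s), NOT attempted.  This is not "finishing BSD".  Nothing here is booked; no
mark / label / count / tier moves.

WHAT THIS FILE DOES (b2b-bsdres REFEREE 2 GEN 192 nit n202, second half; lit GEN 154 P.S.,
HOME/INBOX 2026-08-27T12:26:08Z: "re-pointing the consumers is the X11b team's pen").  The ENDs of
`X11b/KolyvaginShaAtPrimeDischarged` (x11b3-p2 GEN 52) — `Ш(E/K)[p^∞]` finite and
`p^{m+1} ∤ y_K ⟹ p^{m} · Ш(E/K)[p^∞] = 0` on (KN_p) — carry EXACTLY ONE inline cite-only binder
`hγ` (Gross 1991 Prop. 3.7 (2), the Eichler–Shimura congruence `y_n ≡ Frob(λ_m)(y_m) (mod λ_n)`,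
30 lines of statement).  That proposition is now a NAMED, `[cite:]`-tagged Literature fact of the
tree: `Literature.NumberTheory.EllipticCurves.GrossLMS1991.prop37_2_reductionCongruence N W K p`
(`GrossLMS1991/HeegnerEulerSystemCongruence.lean`, lit GEN 154, p530891; registry §E E622), whose
body after Gross's six standing hypotheses (`E` without CM, `d_K ∉ {−3, −4}`, `p` an odd prime with
`ρ̄_{E,p}` onto, `N = N_E`) IS the binder `hγ` character for character (its proved unfolding
`prop37_2_reductionCongruence.endBinder`; kernel-confirmed "on the nose" by bsd-cited r05, sheet
Q65-pre).  THIS FILE re-issues both ENDs — and the seat's root END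
`KolyvaginAssembly.hpoints_at_of_perLevelChoice_of_GZ_of_gamma` (`X11b/KolyvaginLeafInputsDischarged`)
— with `hγ` TAKEN BY NAME: the binder `(hγ : prop37_2_reductionCongruence N W K p)` replaces the
inline statement; every other binder and the conclusion VERBATIM; proof = the parent END applied to
`hγ.endBinder`, the six standing hypotheses being the ENDs' OWN hypotheses (`_hE`, `_hD`, `hp`,
`hp2`, `_hρ`, `hN`).  Net effect: for `E/ℚ` globally minimal without CM at `N = N_E`, `K` imaginary
quadratic Heegner with `d_K ∉ {−3, −4}`, a non-torsion Heegner point `y_K`, `p` odd with `ρ̄_{E,p}`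
onto and (KN_p), the finiteness of `Ш(E/K)[p^∞]` and its annihilation by `p^{m}` are theorems
CONDITIONAL on NAMED PUBLISHED FACTS ONLY — no inline cite-only hypothesis remains in the X11b
Kolyvagin telescope at a surjective prime on (KN_p).  The named fact is NOT discharged (size XL:
CM points on `X_0(N)` mod `ℓ` + Eichler–Shimura; lit GEN 154); its image-free sibling
`GrossLMS1991.prop37_2_frobeniusCongruence` (Nekovář 2007 Prop. 4.9 / 4.13 (ii); bsd-stepL-lit g24,
p534286, §E E659) implies it by the tree theorem
`prop37_2_reductionCongruence_of_frobeniusCongruence`, so the two are ONE debt.  The `p = 3` class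
forms on X11b @ 3 ∩ (KN₃)/ℚ are `Three/KolyvaginShaThreeOfProp37` / `…RatOfProp37`; the ORDER
forms `KolyvaginShaOrderAtPrimeOfProp37` / `Three/KolyvaginShaOrderThreeOfProp37`.  Nothing else
is claimed; nothing booked; X11b @ `p` stays OPEN / CONSTRUCTION-SHAPED (Kolyvagin bounds `Ш`
relative to the Heegner index; it is not `BSD_p`).

## What is proved

* `KolyvaginDischarged.sha_primary_finite_at_of_kodairaNeron_of_prop37` — `Ш(E/K)[p^∞]` finite at
  `p`, modulo the NAMED fact `prop37_2_reductionCongruence N W K p` + `hN` + (KN_p).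
* `KolyvaginDischarged.pow_smul_sha_primary_eq_zero_at_of_kodairaNeron_of_prop37` —
  `p^{m+1} ∤ y_K ⟹ p^{m} · Ш(E/K)[p^∞] = 0`, same footing.
* `KolyvaginAssembly.hpoints_at_of_perLevelChoice_of_GZ_of_prop37` — the root END (McCallum's
  `hpoints` clause at one prime) from {`hGZ`, the NAMED fact}; carries Gross's standing hypothesis
  `hE : ¬ W.HasCM` as an EXTRA binder (the parent root END does not have it in scope).

## References

* [GrossLMS1991] B. H. Gross, *Kolyvagin's work on modular elliptic curves*, LMS LNS 153 (1991),
  Thm. 1.3 (2), §3 Prop. 3.7 (2) (p. 240), Prop. 5.3, Prop. 6.2 (1).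
* [McCallumLMS1991] W. G. McCallum, *Kolyvagin's work on Shafarevich–Tate groups*, same volume,
  §1 Theorem (Kolyvagin), §2 Prop. 2.2, Lemma 5.1.
* [Nekovar2007] J. Nekovář, *The Euler system method for CM points on Shimura curves*, LMS LNS 320
  (2007), Prop. 4.9, 4.13 (ii) (the image-free sibling).
* [SilvermanAEC2009] Thm. VII.6.1; [GrossZagier1986] III (3.1); [Darmon2004] Thm. 3.6, Thm. 3.7.

presearch: `lean search 'of_prop37'` → none; `lean search 'prop37_2_reductionCongruence'` → the
fact file + its image-free sibling only (0 Summits consumers before this file); parents = the tree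
ENDs named above; [corpus:book:editornd-l-functions-arithmetic p0217 L19–L22 (Prop. 3.7)] is the
fact's locator; nothing minted.
-/

noncomputable section

open scoped Classical
open WeierstrassCurve Field NumberField IsDedekindDomain
open Literature.NumberTheory.EllipticCurves Literature.NumberTheory.GaloisRepresentations
open Literature.NumberTheory.EllipticCurves.RingClassField
open Literature.NumberTheory.EllipticCurves.ModularForms
open Literature.NumberTheory.DiophantineGeometry Literature.NumberTheory.DiophantineGeometry.TateAlgorithm
open Literature.NumberTheory.EllipticCurves.GrossLMS1991 (prop37_2_reductionCongruence)

namespace Summit.BirchSwinnertonDyer.Rank1Residual.X11b.KolyvaginDischarged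

-- `K : Type`: the tree's ring-class class field theory is universe `0`.
variable {K : Type} [Field K] [NumberField K] {N : ℕ} {W : WeierstrassCurve ℚ}

/-- **`Ш(E/K)[p^∞]` finite at ONE odd surjective prime `p` on the Kodaira–Néron sub-class AT `p` —
modulo the NAMED fact `GrossLMS1991.prop37_2_reductionCongruence N W K p` (Gross 1991 Prop. 3.7 (2)
BY NAME), no inline cite-only input.**  The tree END `sha_primary_finite_at_of_kodairaNeron`
(`X11b/KolyvaginShaAtPrimeDischarged`) with its inline binder `hγ` SUPPLIED by `hγ.endBinder` under
the END's own hypotheses `_hE`, `_hD`, `hp`, `hp2`, `_hρ`, `hN`; every other binder and the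
conclusion VERBATIM.  For `E = W/ℚ` globally minimal, `¬ CM`, `N = N_E` (`hN`), `K` imaginary
quadratic Heegner with `d_K ∉ {−3, −4}`, `P` a non-torsion Heegner point, `p` odd with `ρ̄_{E,p}`
onto, (KN_p) (`hKNm`, `hKNa`).  CONDITIONAL on EXACTLY the named fact {`hγ`} AT `p` (PUBLISHED,
NOT discharged) + `hN` + (KN_p); nothing booked; no mark / count / tier moves.
[cite: McCallumLMS1991, §1 Theorem (Kolyvagin)] [cite: GrossLMS1991, Thm. 1.3 (2), §3 Prop. 3.7 (2) (p. 240), Prop. 6.2 (1)]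
[cite: SilvermanAEC2009, Thm. VII.6.1] -/
theorem sha_primary_finite_at_of_kodairaNeron_of_prop37 [NeZero N]
    [W.IsGloballyMinimal] {p : ℕ} (hp : p.Prime) (hp2 : p ≠ 2)
    (hN : ∀ [W.IsElliptic], N = W.conductorNorm ℤ)
    (hKNm : ∀ [W.IsElliptic] (v : HeightOneSpectrum (𝓞 K)),
      (W.baseChange K).HasMultiplicativeReductionAt v →
        ¬ p ∣ (W.baseChange K).ordMinimalDiscriminant v)
    (hKNa : ∀ [W.IsElliptic] (v : HeightOneSpectrum (𝓞 K)),
      (W.baseChange K).HasAdditiveReductionAt v → p ≠ 3 ∨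
        ((W.baseChange K).kodairaSymbolAt v ≠ KodairaSymbol.IV ∧
          (W.baseChange K).kodairaSymbolAt v ≠ KodairaSymbol.IVstar))
    (hγ : prop37_2_reductionCongruence N W K p) :
    ∀ [W.IsElliptic] (_hE : ¬ W.HasCM) (_hK : IsImaginaryQuadratic K)
      (_hD : NumberField.discr K ≠ -3 ∧ NumberField.discr K ≠ -4)
      (_hH : SatisfiesHeegnerHypothesis N K)
      {P : (W.baseChange K).toAffine.Point} (_hP : IsHeegnerPoint N W K P)
      (_hnt : ¬ IsOfFinAddOrder P) (_hρ : W.HasSurjectiveModNGaloisRep p),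
      Set.Finite {c : (W.baseChange K).sha | ∃ j : ℕ, p ^ j • c = 0} := by
  intro _ hE hK hD hH P hP hnt hρ
  exact sha_primary_finite_at_of_kodairaNeron hp hp2 hN hKNm hKNa
    (hγ.endBinder (@fun _ ↦ hE) hD hp hp2 (@fun _ ↦ hρ) hN) hE hK hD hH hP hnt hρ

/-- **Kolyvagin's annihilator at ONE odd surjective prime `p` on the Kodaira–Néron sub-class AT
`p`: `p^{m+1} ∤ y_K ⟹ p^{m} · Ш(E/K)[p^∞] = 0` — modulo the NAMED fact
`GrossLMS1991.prop37_2_reductionCongruence N W K p`, no inline cite-only input.**  The tree END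
`pow_smul_sha_primary_eq_zero_at_of_kodairaNeron` (`X11b/KolyvaginShaAtPrimeDischarged`) with its
inline binder `hγ` SUPPLIED by `hγ.endBinder` under the END's own hypotheses; binders/conclusion
otherwise VERBATIM.  CONDITIONAL on EXACTLY the named fact {`hγ`} AT `p` + `hN` + (KN_p); nothing
booked; no mark.
[cite: McCallumLMS1991, §1 Theorem (Kolyvagin), §2 Prop. 2.2, Lemma 5.1]
[cite: GrossLMS1991, Thm. 1.3 (2), §3 Prop. 3.7 (2) (p. 240), Prop. 6.2 (1)] [cite: SilvermanAEC2009, Thm. VII.6.1] -/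
theorem pow_smul_sha_primary_eq_zero_at_of_kodairaNeron_of_prop37 [NeZero N]
    [W.IsGloballyMinimal] {p : ℕ} (hp : p.Prime) (hp2 : p ≠ 2)
    (hN : ∀ [W.IsElliptic], N = W.conductorNorm ℤ)
    (hKNm : ∀ [W.IsElliptic] (v : HeightOneSpectrum (𝓞 K)),
      (W.baseChange K).HasMultiplicativeReductionAt v →
        ¬ p ∣ (W.baseChange K).ordMinimalDiscriminant v)
    (hKNa : ∀ [W.IsElliptic] (v : HeightOneSpectrum (𝓞 K)),
      (W.baseChange K).HasAdditiveReductionAt v → p ≠ 3 ∨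
        ((W.baseChange K).kodairaSymbolAt v ≠ KodairaSymbol.IV ∧
          (W.baseChange K).kodairaSymbolAt v ≠ KodairaSymbol.IVstar))
    (hγ : prop37_2_reductionCongruence N W K p) :
    ∀ [W.IsElliptic] (_hE : ¬ W.HasCM) (_hK : IsImaginaryQuadratic K)
      (_hD : NumberField.discr K ≠ -3 ∧ NumberField.discr K ≠ -4)
      (_hH : SatisfiesHeegnerHypothesis N K)
      {P : (W.baseChange K).toAffine.Point} (_hP : IsHeegnerPoint N W K P)
      (_hnt : ¬ IsOfFinAddOrder P) (_hρ : W.HasSurjectiveModNGaloisRep p) {m : ℕ}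
      (_hm : ∀ Q : (W.baseChange K).toAffine.Point, p ^ (m + 1) • Q ≠ P) (c : (W.baseChange K).sha),
      (∃ j : ℕ, p ^ j • c = 0) → p ^ m • c = 0 := by
  intro _ hE hK hD hH P hP hnt hρ m hm c hc
  exact pow_smul_sha_primary_eq_zero_at_of_kodairaNeron hp hp2 hN hKNm hKNa
    (hγ.endBinder (@fun _ ↦ hE) hD hp hp2 (@fun _ ↦ hρ) hN) hE hK hD hH hP hnt hρ hm c hc

end Summit.BirchSwinnertonDyer.Rank1Residual.X11b.KolyvaginDischarged

namespace Summit.BirchSwinnertonDyer.Rank1Residual.X11b.KolyvaginAssembly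

-- `K : Type`: the tree's ring-class class field theory is universe `0`.
variable {K : Type} [Field K] [NumberField K] {N : ℕ} {W : WeierstrassCurve ℚ}

/-- **The root END at one prime from {`hGZ`, Gross 1991 Prop. 3.7 (2) BY NAME}** — McCallum's
`hpoints` clause (the Kolyvagin system `(ε, τ, A, Pt)` with its eigen-relation, local conditions
away from `m` and the key local relation at `ℓ ∣ m`) for the concrete per-level Kolyvagin–Heegner
data at ONE odd surjective prime `p`: the tree root END
`hpoints_at_of_perLevelChoice_of_GZ_of_gamma` (`X11b/KolyvaginLeafInputsDischarged`; leaves `hrec`,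
`hCM`, `h53` already tree theorems there) with its inline binder `hγ` SUPPLIED by
`hγ.endBinder` from the NAMED fact `GrossLMS1991.prop37_2_reductionCongruence N W K p`.  Gross's
standing hypothesis `E` without CM is NOT among the parent's binders, so it is carried here as the
EXTRA binder `hE : ¬ W.HasCM` (§2 of the paper; every downstream `Ш` END has it in scope); all
other binders and the conclusion VERBATIM.  CONDITIONAL on EXACTLY {`hGZ` = [GZ86 III (3.1)]
local receptacle statement, cite-only; the named fact `hγ`}; nothing booked; no mark.
[cite: McCallumLMS1991, §1 Theorem (Kolyvagin), §§4–5] [cite: GrossLMS1991, §3 Prop. 3.7 (2) (p. 240), Prop. 5.3, §2 (p. 237)]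
[cite: GrossZagier1986, III (3.1)] -/
theorem hpoints_at_of_perLevelChoice_of_GZ_of_prop37 [NeZero N] [W.IsGloballyMinimal]
    [W.IsElliptic] (hN : N = W.conductorNorm ℤ) (hE : ¬ W.HasCM) (hK : IsImaginaryQuadratic K)
    (hD34 : NumberField.discr K ≠ -3 ∧ NumberField.discr K ≠ -4)
    (hH : SatisfiesHeegnerHypothesis N K) {P : (W.baseChange K).toAffine.Point}
    (hHP : IsHeegnerPoint N W K P) {p : ℕ} (hp : p.Prime) (hp2 : p ≠ 2)
    (hρ : W.HasSurjectiveModNGaloisRep p)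
    (hGZ : ∀ [W.IsElliptic] (_hK : IsImaginaryQuadratic K) (_hH : SatisfiesHeegnerHypothesis N K)
      (Dt : ModularParametrizationData W N) (β : ℤ) (ι : K →+* ℂ) {M : ℕ} (_hM : 1 ≤ M) {n : ℕ}
      (_hn : Squarefree n)
      (_hKol : ∀ q ∈ n.primeFactors, IsKolyvaginPrime N W K p q ∧ FrobEqFrobInfty W K (p ^ M) q)
      (d : (m : ℕ) → m ∣ n → KolyvaginHeegnerData Dt β ι m),
      ∃ n' : ℤ, IsCoprime ((p ^ M : ℕ) : ℤ) n' ∧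
        ∀ (m : ℕ) (hm : m ∣ n) (γ : ringClassField K ι m ≃ₐ[ℚ] ringClassField K ι m),
          γ ∈ ringClassGal ι m → ∀ v : HeightOneSpectrum (𝓞 K),
            ¬ (W.baseChange K).HasGoodReductionAt v →
            n' • pointsMap (W.baseChange K) (v.adicCompletion K)
                ((d m hm).toGeomPoints (pointGalHom W (ringClassField K ι m) γ (d m hm).y)) ∈
              E0Receptacle (W.baseChange K) v ∧
            ∀ (ℓ : ℕ) (hℓ : ℓ ∈ m.primeFactors)
              (hle : ringClassField K ι (m / ℓ) ≤ ringClassField K ι m),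
              n' • pointsMap (W.baseChange K) (v.adicCompletion K)
                  ((d m hm).toGeomPoints (pointGalHom W (ringClassField K ι m) γ
                    (WeierstrassCurve.Affine.Point.map (W' := W)
                      ((RingClassField.inclusion ι hle).restrictScalars ℚ)
                      (d (m / ℓ)
                        ((Nat.div_dvd_of_dvd (Nat.dvd_of_mem_primeFactors hℓ)).trans hm)).y))) ∈
                E0Receptacle (W.baseChange K) v)
    (hγ : prop37_2_reductionCongruence N W K p) :
    ∀ {M : ℕ} (_hM : 1 ≤ M)
      (hdiv : ∀ Q : geomPoints (W.baseChange K), ∃ R, ((p ^ M : ℕ) : ℤ) • R = Q)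
      (c : K ≃ₐ[ℚ] K) (_hc : c ≠ 1),
      ∃ (ε : ℤ) (τ : AlgebraicClosure K ≃+* AlgebraicClosure K) (hτ : IsLiftOfAut c τ)
        (A : ℕ → AddSubgroup (geomPoints (W.baseChange K)))
        (hA : ∀ m, KolyvaginCocycle.IsAdmissible (Field.absoluteGaloisGroup K) (A m)
          ((p ^ M : ℕ) : ℤ))
        (Pt : ℕ → geomPoints (W.baseChange K))
        (hPt : ∀ m, Pt m ∈
          KolyvaginCocycle.invPoints (Field.absoluteGaloisGroup K) (A m) ((p ^ M : ℕ) : ℤ)),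
        (ε = 1 ∨ ε = -1) ∧
        IsOfFinAddOrder (Affine.Point.map (W' := W) (c : K →ₐ[ℚ] K) P - ε • P) ∧
        (∀ m, ∀ a ∈ A m, hτ.pointsMap W a ∈ A m) ∧
        Pt 1 = toGeomPoints (W.baseChange K) P ∧
        (∀ m : ℕ, Squarefree m →
          (∀ q ∈ m.primeFactors, IsKolyvaginPrime N W K p q ∧ FrobEqFrobInfty W K (p ^ M) q) →
          (∃ B ∈ A m, hτ.pointsMap W (Pt m) =
            (ε * (-1) ^ m.primeFactors.card) • Pt m + ((p ^ M : ℕ) : ℤ) • B) ∧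
          (∀ v : HeightOneSpectrum (𝓞 K), (m : 𝓞 K) ∉ v.asIdeal →
            kolyvaginClass (W.baseChange K) _ hdiv (hA m) (Pt m) (hPt m) ∈
              selmerLocalKer (W.baseChange K) (v.adicCompletion K) ((p ^ M : ℕ) : ℤ)) ∧
          (∀ ℓ : ℕ, ℓ.Prime → ℓ ∣ m → ∀ v : HeightOneSpectrum (𝓞 K), (ℓ : 𝓞 K) ∈ v.asIdeal →
            ∀ a : ℕ, (((p : ℤ) ^ a) •
                kolyvaginClass (W.baseChange K) _ hdiv (hA m) (Pt m) (hPt m) ∈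
                selmerLocalKer (W.baseChange K) (v.adicCompletion K) ((p ^ M : ℕ) : ℤ) ↔
              ((p : ℤ) ^ a) • kolyvaginClass (W.baseChange K) _ hdiv (hA (m / ℓ)) (Pt (m / ℓ))
                  (hPt (m / ℓ)) ∈
                (W.baseChange K).torsionLocalKer (v.adicCompletion K) ((p ^ M : ℕ) : ℤ)))) :=
  hpoints_at_of_perLevelChoice_of_GZ_of_gamma hN hK hD34 hH hHP hp hp2 hρ hGZ
    (hγ.endBinder (@fun _ ↦ hE) hD34 hp hp2 (@fun _ ↦ hρ) (@fun _ ↦ hN))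

end Summit.BirchSwinnertonDyer.Rank1Residual.X11b.KolyvaginAssembly

end
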